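import Mathlib.Data.Nat.Log
import Mathlib.Data.Nat.Bits
import Literature.Computability.Complexity.TimeBounds
import Literature.Computability.Complexity.BoolEncodings
import Literature.Computability.AlgebraicComplexity.ArithCircuit
import Literature.Computability.AlgebraicComplexity.ValiantClasses
import HarnessLib

/-!
# Explicitness of polynomial mappings: Raz's poly(n)-definability, and explicit curves

Trunk T-CPLX-ALG (Literature/Computability/AlgebraicComplexity); definition request
`defn-IsRazExplicit` (route ValiantsHypothesis/Elusive, item stmt-ValiantsHypothesis-0338).

Raz (2010) shows that *explicit* elusive polynomial mappings give arithmetic circuit lower bounds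
(e.g. Cor. 1.6, Cor. 1.14: explicit `(s, 2)`-elusive `f : Fⁿ → Fᵐ` ⇒ super-polynomial circuits
for the permanent), where **explicit means poly(n)-definable (Def. 1.3)**, Raz's extension of
Valiant's p-definability (`VNP`) from polynomials to polynomial mappings:

> **Definition 1.3.** A polynomial mapping `f : Fⁿ → Fᵐ` is *poly(n)-definable* if for some
> `ℓ = poly(n)`, and for `k = ⌈log₂ m⌉`, there exists a polynomial
> `g ∈ F[x₁,…,xₙ, e₁,…,e_ℓ, w₁,…,w_k]` of degree `poly(n)`, that can be computed by an arithmetic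
> circuit of size `poly(n)`, and such that for every `i ∈ {1,…,m}`,
> `fᵢ(x) = Σ_{e ∈ {0,1}^ℓ} g(x, e, i₁, …, i_k)`, `(i_k,…,i₁)` the binary representation of `i - 1`.

Raz adds (after Def. 1.3, citing Bürgisser 2000, Prop. 4.4 = Valiant's criterion): if `f` is
multilinear with all coefficients in `{0,1}` and a deterministic polynomial-time Turing machine on
inputs `i` and `e ∈ {0,1}ⁿ` outputs the coefficient of `x^e` in `fᵢ`, then `f` is
poly(n)-definable.

## Contents

* `IsPolyDefinableMap f` — Def. 1.3 verbatim for a FAMILY `f n : Fin (m n) → MvPolynomial (σ n) k`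
  ("poly(n)" is asymptotic in the index `n`; `i` is `0`-based so the bits are those of `i`), using
  the tree's `boolSum` (Valiant's Boolean sum), `complexity` (least circuit size) and `IsPBounded`.
* `IsRazExplicit f` — the requester's Turing-machine coefficient criterion for CURVE families
  `f m : Fin m → Polynomial ℤ` (the setting of Raz's abstract, `f : ℂ → ℂᵐ`): the coefficient map
  `(m, i, e) ↦ coeff (f m i) e ∈ ℤ` (`curveCoeff f`) is computable in time polynomial in the bit
  length of `(m, i, e)` (`Literature.Computability.Complexity.PolyTimeComputable` w.r.t. the tree's Boolean encodings of
  `ℕ × ℕ × ℕ` and `ℤ`). This is NOT literally Def. 1.3: it is modelled on Raz's Turing-machine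
  remark (there: `{0,1}` coefficients, time `poly(n)` on input `(i, e)`) transported to curves along
  the multilinearisation `x^e ↦ ∏_j x_j^{e_j}` of Prop. 1.2 (`n` = bit length of the degree), and
  on Bürgisser's form of Valiant's criterion (coefficient function in `FP`/`#P` ⇒ `VNP`), which
  allows integer coefficients. The bridge "`IsRazExplicit f` ⇒ the multilinearised family is
  `IsPolyDefinableMap` over every field" is a consequence of Valiant's criterion and is left to the
  route (it is not a printed statement).

## Sources

* R. Raz, *Elusive functions and lower bounds for arithmetic circuits*, Theory of Computing 6
  (2010) 135–177: Def. 1.3 (poly(n)-definable mappings) and the remark following it; §1.4,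
  Prop. 1.2 (multilinearisation); abstract/§1.2 (explicit curves `ℂ → ℂᵐ`).
* P. Bürgisser, *Completeness and reduction in algebraic complexity theory* (2000), Def. 2.5
  (p-definable), Prop. 2.20 (Valiant's criterion).

## Design choices

* Family indexing follows `ValiantClasses.lean` (`σ : ℕ → Type v`, no cardinality constraint on
  `σ n`, as Raz imposes none beyond the circuit for `g`); `m : ℕ → ℕ` is the output arity.
* The `w`-variables are substituted by the bits `Nat.testBit i t` of the (0-based) index before the
  Boolean sum, so Def. 1.3's displayed identity is `f n i = boolSum (aeval (bits of i) (g n))`.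
* `curveCoeff` returns the junk value `0` for `i ≥ m` (never queried on valid indices).
* Mathlib/tree: `PolyTimeComputable`, `encodingNatBool`, `encodingIntBool`, `pairBool`,
  `boolSum`, `complexity`, `IsPBounded` are reused; nothing here duplicates `IsVNPFamily`
  (which is the `m = 1`, no-`w` case).
-/

noncomputable section

open MvPolynomial Computability

namespace Literature.Computability.AlgebraicComplexity

universe u v

/-! ### Raz's poly(n)-definable polynomial mappings (Def. 1.3) -/

section PolyDefinable

variable {k : Type u} [CommSemiring k] {σ : ℕ → Type v} {m : ℕ → ℕ}

/-- Substituting the bits of the index `i` for the `w`-variables: the `k`-algebra map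
`k[x, e, w] → k[x, e]`, `x, e ↦ themselves`, `w_t ↦ bit_t(i) ∈ {0, 1}`.
[Raz 2010, Def. 1.3 (`g(x, e, i₁, …, i_k)`)] [cite: Raz2010, Def. 1.3] -/
def bitSubst (n : ℕ) (ℓ kw : ℕ) (i : ℕ) :
    MvPolynomial ((σ n ⊕ Fin ℓ) ⊕ Fin kw) k →ₐ[k] MvPolynomial (σ n ⊕ Fin ℓ) k :=
  aeval (Sum.elim X fun t => if i.testBit t then 1 else 0)

/-- **Raz's poly(n)-definable polynomial mappings** (Def. 1.3), for a family
`f n = (f n 0, …, f n (m n - 1)) : k^{σ n} → k^{m n}`: there are `ℓ = poly(n)` and polynomials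
`g n ∈ k[x, e₁…e_ℓ, w₁…w_k]`, `k = ⌈log₂ (m n)⌉`, of degree `poly(n)` and circuit complexity
`poly(n)`, with `f n i = Σ_{e ∈ {0,1}^ℓ} g n (x, e, bits(i))` for every `i` (0-based index, so
"binary representation of `i - 1`" for Raz's 1-based `i`). Note the circuit for `g n` may depend
polynomially on `n` but NOT on `m n`. [Raz 2010, Def. 1.3] [cite: Raz2010, Def. 1.3] -/
def IsPolyDefinableMap (f : ∀ n, Fin (m n) → MvPolynomial (σ n) k) : Prop :=
  ∃ (ℓ : ℕ → ℕ) (g : ∀ n, MvPolynomial ((σ n ⊕ Fin (ℓ n)) ⊕ Fin (Nat.clog 2 (m n))) k),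
    IsPBounded ℓ ∧ IsPBounded (fun n => (g n).totalDegree) ∧
      IsPBounded (fun n => complexity (g n)) ∧
        ∀ (n : ℕ) (i : Fin (m n)), f n i = boolSum (bitSubst n (ℓ n) (Nat.clog 2 (m n)) i (g n))

end PolyDefinable

/-! ### Explicit curve families (Turing-machine coefficient criterion) -/

/-- The coefficient function of a family of integer polynomial curves `f m : Fin m → ℤ[x]`:
`(m, i, e) ↦ coeff (f m i) e`, with junk value `0` for `i ≥ m`.
[Raz 2010, remark after Def. 1.3 (the map `(i, e) ↦` coefficient)] [cite: Raz2010, Def. 1.3] -/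
def curveCoeff (f : ∀ m, Fin m → Polynomial ℤ) : ℕ × ℕ × ℕ → ℤ :=
  fun t => if h : t.2.1 < t.1 then (f t.1 ⟨t.2.1, h⟩).coeff t.2.2 else 0

/-- The Boolean input encoding of a coefficient query `(m, i, e)` (iterated `pairBool` of binary
encodings, as for other triple inputs in the tree). [Arora–Barak 2009, §0.1] [folklore] -/
def encodeCoeffQuery : ℕ × ℕ × ℕ → List Bool :=
  (encodingNatBool.pairBool (encodingNatBool.pairBool encodingNatBool)).encode

/-- **`IsRazExplicit f`** (explicit curve family, Turing-machine form): the integer coefficient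
`coeff (f m i) e` of `x^e` in the `i`-th coordinate of the curve `f m : ℤ → ℤ^m` is computable
by a Turing machine in time polynomial in the bit length of `(m, i, e)` (so in particular the
coefficients have polynomially many bits). Modelled on Raz's remark after Def. 1.3 (poly-time
computable `{0,1}` coefficients of a multilinear map ⇒ poly(n)-definable, via Valiant's criterion,
Bürgisser 2000 Prop. 2.20) read through the multilinearisation of Prop. 1.2; Raz's own
explicitness notion in the theorems is `IsPolyDefinableMap`. [Raz 2010, Def. 1.3 and the remark
following it, Prop. 1.2; Bürgisser 2000, Prop. 2.20] [cite: Raz2010, Def. 1.3] -/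
def IsRazExplicit (f : ∀ m, Fin m → Polynomial ℤ) : Prop :=
  Literature.Computability.Complexity.PolyTimeComputable encodeCoeffQuery Literature.Computability.Complexity.encodingIntBool.encode
    (curveCoeff f)

/-! ### API -/

/-- `curveCoeff` on a valid index. [folklore] -/
@[simp] theorem curveCoeff_of_lt (f : ∀ m, Fin m → Polynomial ℤ) {m i : ℕ} (h : i < m) (e : ℕ) :
    curveCoeff f (m, i, e) = (f m ⟨i, h⟩).coeff e := by
  simp [curveCoeff, h]

/-- `curveCoeff` is the junk value `0` beyond the arity. [folklore] -/
@[simp] theorem curveCoeff_of_le (f : ∀ m, Fin m → Polynomial ℤ) {m i : ℕ} (h : m ≤ i) (e : ℕ) :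
    curveCoeff f (m, i, e) = 0 := by
  simp [curveCoeff, not_lt.2 h]

/-- The query encoding is injective. [folklore] -/
theorem encodeCoeffQuery_injective : Function.Injective encodeCoeffQuery :=
  (encodingNatBool.pairBool (encodingNatBool.pairBool encodingNatBool)).encode_injective

section PolyDefinable

variable {k : Type u} [CommSemiring k] {σ : ℕ → Type v}

/-- `bitSubst` fixes the `x`- and `e`-variables. [Raz 2010, Def. 1.3] [folklore] -/
@[simp] theorem bitSubst_X_inl (n ℓ kw i : ℕ) (a : σ n ⊕ Fin ℓ) :
    bitSubst (k := k) n ℓ kw i (X (Sum.inl a)) = X a := by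
  simp [bitSubst]

/-- `bitSubst` sends `w_t` to the `t`-th bit of the index. [Raz 2010, Def. 1.3] [folklore] -/
@[simp] theorem bitSubst_X_inr (n ℓ kw i : ℕ) (t : Fin kw) :
    bitSubst (k := k) (σ := σ) n ℓ kw i (X (Sum.inr t)) = if i.testBit t then 1 else 0 := by
  simp [bitSubst]

/-- Unfolding `IsPolyDefinableMap`. [Raz 2010, Def. 1.3] [folklore] -/
theorem isPolyDefinableMap_iff {m : ℕ → ℕ} (f : ∀ n, Fin (m n) → MvPolynomial (σ n) k) :
    IsPolyDefinableMap f ↔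
      ∃ (ℓ : ℕ → ℕ) (g : ∀ n, MvPolynomial ((σ n ⊕ Fin (ℓ n)) ⊕ Fin (Nat.clog 2 (m n))) k),
        IsPBounded ℓ ∧ IsPBounded (fun n => (g n).totalDegree) ∧
          IsPBounded (fun n => complexity (g n)) ∧
            ∀ (n : ℕ) (i : Fin (m n)),
              f n i = boolSum (bitSubst n (ℓ n) (Nat.clog 2 (m n)) i (g n)) :=
  Iff.rfl

end PolyDefinable

end Literature.Computability.AlgebraicComplexity
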